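import Literature.NumberTheory.IwasawaTheory.Greenberg2006.CohomologyCofiniteGenerationAssembly
import Literature.NumberTheory.GaloisRepresentations.ContinuousH1FiniteOfBoundedIndex
import HarnessLib

/-!
# Greenberg 2006, Prop. 3.2, GLOBAL clause in low degrees — unconditionally: `H⁰(K_Σ/K, 𝒟)` and
# `H¹(K_Σ/K, 𝒟)` are cofinitely generated

R. Greenberg, *On the structure of certain Galois cohomology groups*, Doc. Math. Extra Vol. Coates
(2006), Prop. 3.2 (p. 358 L37): "For any `i ≥ 0`, `Hⁱ(G, D)` is a cofinitely generated `R`-module",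
case (ii) `G = Gal(K_Σ/K)`.  Print's proof is a dévissage in which `Hⁱ` only meets `Hⁱ` and `Hⁱ⁻¹`
of subquotients (tree: `ContinuousRep.module_finite_characterModule_continuousCohomology_of_le`,
`ContinuousCohomologyCofiniteGeneration.lean`), fed by the standing hypothesis (F) "`Hⁱ(G, α)` finite
for finite `α`".  For `G = G_{K,S}` (`S` finite) the tree PROVES (F) in degrees `0` and `1`
(`ContinuousRep.finite_continuousCohomology_zero`; degree `1` by Hermite, no class field theory:
theorem of record `finite_H_one_unramifiedOutside` (`UnramifiedOutsideH1Finite.lean`, w2 g7), used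
here through its twin packaging `hypothesisF_le_one_galoisGroupUnramifiedOutside`
(`ContinuousH1FiniteOfBoundedIndex.lean`)), while degree `2` is Neukirch–Schmidt–Wingberg (8.3.20) (named fact
`GaloisCohomology.finite_restrictedCohomology`).  Hence:

* `isCofinitelyGenerated_H_of_hypF_le` — the global clause in degrees `≤ N` from (F) for `G_{K,S}`
  in degrees `≤ N`, at the binders of the named fact `prop32_cohomology_isCofinitelyGenerated`
  (`Λ ≃+* ℤ_p⟦T₁,…,T_m⟧`, `𝒟` discrete cofinitely generated);
* **`isCofinitelyGenerated_H_of_le_one`** — for `S` finite, `Hⁱ(K_Σ/K, 𝒟)` is cofinitely generated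
  for `i ≤ 1`, UNCONDITIONALLY (`isCofinitelyGenerated_H_one` the case `i = 1`).

Companion of `CohomologyCofinitelyGeneratedLocal.lean` (the local clause at every place, all
degrees) and `CohomologyCofiniteGenerationAssembly.lean` (`prop32_of_hypF`).

## References
* R. Greenberg, *On the structure of certain Galois cohomology groups*, Doc. Math. Extra Vol.
  Coates (2006) 335–391, §3 A (p. 358 L8–13; Prop. 3.2 p. 358 L37 – p. 359 L18). [Greenberg2006]
* J. Neukirch, A. Schmidt, K. Wingberg, *Cohomology of Number Fields*, 2nd ed. (2008), (8.3.20).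
  [NeukirchSchmidtWingberg2008]
-/

noncomputable section

open scoped Classical
open NumberField IsDedekindDomain Field IsLocalRing
open Literature.NumberTheory.GaloisRepresentations
open Literature.NumberTheory.IwasawaTheory.Greenberg2016

namespace Literature.NumberTheory.IwasawaTheory.Greenberg2006

variable {K : Type} [Field K] [NumberField K] (S : Set (HeightOneSpectrum (𝓞 K)))
  {p : ℕ} [Fact p.Prime] {m : ℕ}
  {Λ : Type} [CommRing Λ] [TopologicalSpace Λ]
  {D : Type} [AddCommGroup D] [Module Λ D] [TopologicalSpace D] [DiscreteTopology D]
  [ContinuousSMul Λ D]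
  (ρ : ContinuousRep (GaloisGroupUnramifiedOutside K S) Λ D)

/-- **Greenberg 2006 Prop. 3.2, GLOBAL clause in degrees `≤ N`, from the standing hypothesis (F)
for `Gal(K_Σ/K)` in degrees `≤ N`**: for `Λ ≅ ℤ_p⟦T₁,…,T_m⟧` and `𝒟` discrete cofinitely generated,
if `Hⁿ(K_Σ/K, A)` is finite for every finite discrete `Λ[G_{K,S}]`-module `A` killed by `𝔪_Λ` (and
by `p`) and every `n ≤ N`, then `Hⁱ(K_Σ/K, 𝒟) = ρ.H i` is cofinitely generated for every `i ≤ N`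
(the dévissage for `Hⁱ` uses only `Hⁱ`, `Hⁱ⁻¹`). [cite: Greenberg2006, Prop. 3.2 (proof, p. 358 L38 – p. 359 L18) with §3 A p. 358 L8–13 (ii)] -/
theorem isCofinitelyGenerated_H_of_hypF_le (e : Λ ≃+* MvPowerSeries (Fin m) ℤ_[p])
    (hD : IsCofinitelyGenerated Λ D) {N : ℕ}
    (hF : ∀ (A : Type) [AddCommGroup A] [Module Λ A] [TopologicalSpace A] [DiscreteTopology A]
      [ContinuousSMul Λ A] [Finite A] (τ : ContinuousRep (GaloisGroupUnramifiedOutside K S) Λ A),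
      (∀ a : A, (p : ℤ) • a = 0) → ∀ n ≤ N, Finite (continuousCohomology n τ.toTopRep))
    {i : ℕ} (hi : i ≤ N) : IsCofinitelyGenerated Λ (ρ.H i) := by
  haveI : IsLocalRing Λ := isLocalRing_of_ringEquiv_mvPowerSeries e
  haveI : IsNoetherianRing Λ := isNoetherianRing_of_ringEquiv_mvPowerSeries e
  haveI : IsAdicComplete (maximalIdeal Λ) Λ := isAdicComplete_maximalIdeal_of_ringEquiv_mvPowerSeries e
  haveI : Finite (Λ ⧸ maximalIdeal Λ) := finite_quotient_maximalIdeal_of_ringEquiv_mvPowerSeries e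
  haveI : Module.Finite Λ (CharacterModule D) :=
    isCofinitelyGenerated_iff_module_finite_characterModule.1 hD
  rw [isCofinitelyGenerated_iff_module_finite_characterModule]
  exact ContinuousRep.module_finite_characterModule_continuousCohomology_of_le (maximalIdeal Λ) N
    (fun A _ _ _ _ _ _ τ hkill n hn => hF A τ
      (zsmul_eq_zero_of_forall_maximalIdeal_smul_eq_zero e hkill) n hn) ρ hi

/-- **Greenberg 2006 Prop. 3.2, GLOBAL clause in degrees `≤ 1` — PROVED unconditionally**: for a
number field `K`, a FINITE set `S` of finite places, `Λ ≅ ℤ_p⟦T₁,…,T_m⟧` and a discrete cofinitely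
generated `Λ`-module `𝒟` with a continuous `Λ`-linear action of `Gal(K_Σ/K)`, the cohomology groups
`H⁰(K_Σ/K, 𝒟)` and `H¹(K_Σ/K, 𝒟)` are cofinitely generated `Λ`-modules ((F) in degree `0`:
invariants of a finite module; degree `1`: Hermite — `finite_H_one_unramifiedOutside`, here via the
packaging `hypothesisF_le_one_galoisGroupUnramifiedOutside`).
[cite: Greenberg2006, Prop. 3.2 (p. 358 L37) with §3 A p. 358 L8–13 (ii)] [cite: NeukirchSchmidtWingberg2008, (8.3.20) (i)] -/
theorem isCofinitelyGenerated_H_of_le_one (e : Λ ≃+* MvPowerSeries (Fin m) ℤ_[p])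
    (hD : IsCofinitelyGenerated Λ D) (hS : S.Finite) {i : ℕ} (hi : i ≤ 1) :
    IsCofinitelyGenerated Λ (ρ.H i) :=
  isCofinitelyGenerated_H_of_hypF_le S ρ e hD (N := 1)
    (fun A _ _ _ _ _ _ τ _ n hn => hypothesisF_le_one_galoisGroupUnramifiedOutside hS A τ n hn) hi

/-- `H¹(K_Σ/K, 𝒟)` is cofinitely generated (unconditionally; `S` finite).
[cite: Greenberg2006, Prop. 3.2 (p. 358 L37) with §3 A p. 358 L8–13 (ii)] -/
theorem isCofinitelyGenerated_H_one (e : Λ ≃+* MvPowerSeries (Fin m) ℤ_[p])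
    (hD : IsCofinitelyGenerated Λ D) (hS : S.Finite) : IsCofinitelyGenerated Λ (ρ.H 1) :=
  isCofinitelyGenerated_H_of_le_one S ρ e hD hS le_rfl

end Literature.NumberTheory.IwasawaTheory.Greenberg2006

end
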